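import Literature.Analysis.TotalPositivity.PolyaFrequencyRootCompactness
import Mathlib.Analysis.Calculus.MeanValue
import Mathlib.Analysis.SpecialFunctions.Log.Summable
import HarnessLib

/-!
# The Laguerre–Pólya product limit (Schoenberg 1951, necessity half, step N4c)

Trunk `Literature/Analysis/TotalPositivity`, seventeenth proofs file accompanying
`PolyaFrequencyFunctions.lean` (the named fact `schoenberg1951_pf_laplace`).  The analytic heart
of the Pólya–Schur/Laguerre–Pólya theorem in the form needed here: let the real rows
`b_l = (b_{l,i})_i` vanish from `N_l` on, be `|·|`-non-increasing, have `Σ_i b_{l,i}² ≤ B'`,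
converge pointwise (`b_{l,i} → δ_i`) and `Σ_i b_{l,i}² → B`.  Then, with `E(w) = (1+w)e^{-w}`,

> `∏_i E(b_{l,i} z) ⟶ exp(−(B − Σ_i δ_i²) z²/2) · ∏_i E(δ_i z)` for every complex `z`

(`tendsto_prod_linExp_rows`): the part of `Σ b²` not captured by the limit configuration escapes
into a Gaussian factor.  Ingredients: `‖E(w)‖ ≤ e^{‖w‖²/2}`, the cubic correction
`E(w) = e^{−w²/2}(1 + u(w))`, `‖u(w)‖ ≤ e^{3/2}‖w‖³` (`‖w‖ ≤ 1`, mean value inequality), and the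
uniform tail bound `|b_{l,i}| ≤ √(B'/(i+1))`. [Schoenberg1951, §9; Pólya–Schur 1914; folklore]

## References

* I. J. Schoenberg, *On Pólya frequency functions. I*, J. Analyse Math. 1 (1951) 331–374, §9.
  [Schoenberg1951]
* N. Obreschkoff, *Verteilung und Berechnung der Nullstellen reeller Polynome* (1963), Kap. II.
  [folklore]
-/

noncomputable section

open Filter Set Finset Complex
open scoped Topology

namespace Literature.Analysis.TotalPositivity

/-! ### Estimates for `E(w) = (1 + w) e^{-w}` -/

/-- `‖E(w)‖ ≤ exp(‖w‖²/2)`. [folklore] -/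
theorem norm_linExp_le (w : ℂ) : ‖(1 + w) * cexp (-w)‖ ≤ Real.exp (‖w‖ ^ 2 / 2) := by
  -- `‖1 + w‖² = 1 + 2 Re w + ‖w‖² ≤ exp(2 Re w + ‖w‖²)`
  have h1 : ‖1 + w‖ ^ 2 = 1 + 2 * w.re + ‖w‖ ^ 2 := by
    rw [Complex.sq_norm, Complex.sq_norm, Complex.normSq_apply, Complex.normSq_apply]
    simp only [Complex.add_re, Complex.one_re, Complex.add_im, Complex.one_im, zero_add]
    ring
  have h2 : ‖1 + w‖ ^ 2 ≤ Real.exp (w.re + ‖w‖ ^ 2 / 2) ^ 2 := by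
    rw [h1, ← Real.exp_nat_mul]
    have h3 := Real.add_one_le_exp (2 * w.re + ‖w‖ ^ 2)
    calc 1 + 2 * w.re + ‖w‖ ^ 2 = 2 * w.re + ‖w‖ ^ 2 + 1 := by ring
      _ ≤ Real.exp (2 * w.re + ‖w‖ ^ 2) := h3
      _ = Real.exp ((2 : ℕ) * (w.re + ‖w‖ ^ 2 / 2)) := by
          congr 1
          push_cast
          ring
  have h4 : ‖1 + w‖ ≤ Real.exp (w.re + ‖w‖ ^ 2 / 2) :=
    (pow_le_pow_iff_left₀ (norm_nonneg _) (Real.exp_pos _).le two_ne_zero).1 h2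
  rw [norm_mul, Complex.norm_exp, Complex.neg_re]
  calc ‖1 + w‖ * Real.exp (-w.re) ≤ Real.exp (w.re + ‖w‖ ^ 2 / 2) * Real.exp (-w.re) := by
        gcongr
    _ = Real.exp (‖w‖ ^ 2 / 2) := by
        rw [← Real.exp_add]
        ring_nf

/-- The cubic correction: `‖(1+w)e^{-w+w²/2} − 1‖ ≤ e^{3/2} ‖w‖³` for `‖w‖ ≤ 1` (its derivative is
`w² e^{-w+w²/2}`; mean value inequality). [folklore] -/
theorem norm_linExp_corr_le {w : ℂ} (hw : ‖w‖ ≤ 1) :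
    ‖(1 + w) * cexp (-w + w ^ 2 / 2) - 1‖ ≤ Real.exp (3 / 2) * ‖w‖ ^ 3 := by
  have hderiv : ∀ ζ, HasDerivAt (fun ζ : ℂ => (1 + ζ) * cexp (-ζ + ζ ^ 2 / 2))
      (ζ ^ 2 * cexp (-ζ + ζ ^ 2 / 2)) ζ := by
    intro ζ
    have h1 : HasDerivAt (fun ζ : ℂ => 1 + ζ) 1 ζ := (hasDerivAt_id ζ).const_add 1
    have h2 : HasDerivAt (fun ζ : ℂ => -ζ + ζ ^ 2 / 2) (-1 + ζ) ζ := by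
      refine (((hasDerivAt_id ζ).neg).add ((hasDerivAt_pow 2 ζ).div_const 2)).congr_deriv ?_
      simp only [Nat.cast_ofNat, Nat.add_one_sub_one, pow_one]
      ring
    refine (h1.mul h2.cexp).congr_deriv ?_
    ring
  have hbound : ∀ ζ ∈ Metric.closedBall (0 : ℂ) ‖w‖,
      ‖deriv (fun ζ : ℂ => (1 + ζ) * cexp (-ζ + ζ ^ 2 / 2)) ζ‖ ≤ Real.exp (3 / 2) * ‖w‖ ^ 2 := by
    intro ζ hζ
    have hζ' : ‖ζ‖ ≤ ‖w‖ := by simpa using hζ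
    have hζ1 : ‖ζ‖ ≤ 1 := hζ'.trans hw
    rw [(hderiv ζ).deriv, norm_mul, Complex.norm_exp, norm_pow]
    have hre : (-ζ + ζ ^ 2 / 2).re ≤ 3 / 2 := by
      have h1 := Complex.re_le_norm (-ζ + ζ ^ 2 / 2)
      have h2 : ‖-ζ + ζ ^ 2 / 2‖ ≤ ‖ζ‖ + ‖ζ‖ ^ 2 / 2 := by
        refine (norm_add_le _ _).trans ?_
        rw [norm_neg, norm_div, norm_pow]
        simp
      nlinarith [norm_nonneg ζ]
    calc ‖ζ‖ ^ 2 * Real.exp ((-ζ + ζ ^ 2 / 2).re) ≤ ‖w‖ ^ 2 * Real.exp (3 / 2) := by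
          gcongr
      _ = Real.exp (3 / 2) * ‖w‖ ^ 2 := mul_comm _ _
  have hw' : w ∈ Metric.closedBall (0 : ℂ) ‖w‖ := by simp
  have hmv := Convex.norm_image_sub_le_of_norm_deriv_le (fun ζ _ => (hderiv ζ).differentiableAt)
    hbound (convex_closedBall (0 : ℂ) ‖w‖) (Metric.mem_closedBall_self (norm_nonneg w)) hw'
  rw [show (1 + (0 : ℂ)) * cexp (-0 + 0 ^ 2 / 2) = 1 by simp, sub_zero] at hmv
  calc ‖(1 + w) * cexp (-w + w ^ 2 / 2) - 1‖ ≤ Real.exp (3 / 2) * ‖w‖ ^ 2 * ‖w‖ := hmv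
    _ = Real.exp (3 / 2) * ‖w‖ ^ 3 := by ring

/-- The factorisation `E(w) = e^{-w²/2} (1 + u(w))`. [folklore] -/
theorem linExp_eq_exp_mul_corr (w : ℂ) :
    (1 + w) * cexp (-w) = cexp (-(w ^ 2 / 2)) * (1 + ((1 + w) * cexp (-w + w ^ 2 / 2) - 1)) := by
  rw [add_sub_cancel, mul_left_comm, ← Complex.exp_add]
  congr 2
  ring

/-! ### The uniform tail estimate -/

/-- **Tail comparison.** If `|u_i| ≤ m` on `Ico I M`, `m ‖z‖ ≤ 1` and `Σ_{Ico I M} u_i² ≤ S`, then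
`‖∏_{Ico I M} E(u_i z) − exp(−(Σ_{Ico I M} u_i²) z²/2)‖ ≤ e^{S‖z‖²/2} (e^{e^{3/2}‖z‖³ m S} − 1)`.
[folklore] -/
theorem norm_prod_linExp_sub_exp_le {u : ℕ → ℝ} {I M : ℕ} {z : ℂ} {m S : ℝ} (hm0 : 0 ≤ m)
    (hm : ∀ i, I ≤ i → |u i| ≤ m) (hmz : m * ‖z‖ ≤ 1)
    (hS : ∑ i ∈ Finset.Ico I M, u i ^ 2 ≤ S) :
    ‖∏ i ∈ Finset.Ico I M, (1 + (u i : ℂ) * z) * cexp (-((u i : ℂ) * z)) -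
        cexp (-(((∑ i ∈ Finset.Ico I M, u i ^ 2 : ℝ) : ℂ) * z ^ 2 / 2))‖ ≤
      Real.exp (S * ‖z‖ ^ 2 / 2) * (Real.exp (Real.exp (3 / 2) * ‖z‖ ^ 3 * m * S) - 1) := by
  have hS0 : 0 ≤ S := le_trans (Finset.sum_nonneg fun i _ => sq_nonneg (u i)) hS
  set ρ : ℕ → ℂ := fun i => (1 + (u i : ℂ) * z) * cexp (-((u i : ℂ) * z) + ((u i : ℂ) * z) ^ 2 / 2) - 1
    with hρ
  have hfac : ∀ i, (1 + (u i : ℂ) * z) * cexp (-((u i : ℂ) * z)) =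
      cexp (-(((u i : ℂ) * z) ^ 2 / 2)) * (1 + ρ i) := fun i => linExp_eq_exp_mul_corr _
  have hprod : ∏ i ∈ Finset.Ico I M, (1 + (u i : ℂ) * z) * cexp (-((u i : ℂ) * z)) =
      cexp (-(((∑ i ∈ Finset.Ico I M, u i ^ 2 : ℝ) : ℂ) * z ^ 2 / 2)) *
        ∏ i ∈ Finset.Ico I M, (1 + ρ i) := by
    simp only [hfac]
    rw [Finset.prod_mul_distrib, ← Complex.exp_sum]
    congr 2
    simp only [Complex.ofReal_sum, Complex.ofReal_pow]
    rw [Finset.sum_mul, Finset.sum_div, ← Finset.sum_neg_distrib]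
    exact Finset.sum_congr rfl fun i _ => by ring
  have hexp : ‖cexp (-(((∑ i ∈ Finset.Ico I M, u i ^ 2 : ℝ) : ℂ) * z ^ 2 / 2))‖ ≤
      Real.exp (S * ‖z‖ ^ 2 / 2) := by
    rw [Complex.norm_exp]
    refine Real.exp_le_exp.2 ?_
    refine (Complex.re_le_norm _).trans ?_
    rw [norm_neg, norm_div, norm_mul, Complex.norm_real, norm_pow, Real.norm_eq_abs,
      abs_of_nonneg (Finset.sum_nonneg fun i _ => sq_nonneg (u i))]
    simp only [Complex.norm_ofNat]
    gcongr
  have hρle : ∀ i ∈ Finset.Ico I M, ‖ρ i‖ ≤ Real.exp (3 / 2) * ‖z‖ ^ 3 * m * u i ^ 2 := by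
    intro i hi
    have hIi : I ≤ i := (Finset.mem_Ico.1 hi).1
    have hw : ‖(u i : ℂ) * z‖ ≤ 1 := by
      rw [norm_mul, Complex.norm_real, Real.norm_eq_abs]
      calc |u i| * ‖z‖ ≤ m * ‖z‖ := by gcongr; exact hm i hIi
        _ ≤ 1 := hmz
    calc ‖ρ i‖ ≤ Real.exp (3 / 2) * ‖(u i : ℂ) * z‖ ^ 3 := norm_linExp_corr_le hw
      _ = Real.exp (3 / 2) * ‖z‖ ^ 3 * |u i| * u i ^ 2 := by
          rw [norm_mul, Complex.norm_real, Real.norm_eq_abs, mul_pow,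
            show |u i| ^ 3 = |u i| * u i ^ 2 by rw [← sq_abs]; ring]
          ring
      _ ≤ Real.exp (3 / 2) * ‖z‖ ^ 3 * m * u i ^ 2 := by
          gcongr
          exact hm i hIi
  have hsumρ : ∑ i ∈ Finset.Ico I M, ‖ρ i‖ ≤ Real.exp (3 / 2) * ‖z‖ ^ 3 * m * S := by
    calc ∑ i ∈ Finset.Ico I M, ‖ρ i‖ ≤ ∑ i ∈ Finset.Ico I M, Real.exp (3 / 2) * ‖z‖ ^ 3 * m * u i ^ 2 :=
          Finset.sum_le_sum hρle
      _ = Real.exp (3 / 2) * ‖z‖ ^ 3 * m * ∑ i ∈ Finset.Ico I M, u i ^ 2 := by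
          rw [Finset.mul_sum]
      _ ≤ Real.exp (3 / 2) * ‖z‖ ^ 3 * m * S := by
          gcongr
  rw [hprod, ← mul_sub_one, norm_mul]
  refine mul_le_mul hexp ?_ (norm_nonneg _) (Real.exp_pos _).le
  calc ‖∏ i ∈ Finset.Ico I M, (1 + ρ i) - 1‖ ≤ Real.exp (∑ i ∈ Finset.Ico I M, ‖ρ i‖) - 1 :=
        Finset.norm_prod_one_add_sub_one_le _ _
    _ ≤ Real.exp (Real.exp (3 / 2) * ‖z‖ ^ 3 * m * S) - 1 := by
        linarith [Real.exp_le_exp.2 hsumρ]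

/-! ### The product limit -/

/-- **The Laguerre–Pólya product limit.** Let the real rows `b_l` vanish from `N_l` on, be
`|·|`-non-increasing, satisfy `Σ_{i<N_l} b_{l,i}² ≤ B'`, converge pointwise to `δ`, and let
`Σ_{i<N_l} b_{l,i}² → B`.  Then `Σ δ_i² ≤ B` and, for every complex `z`,
`∏_{i<N_l} (1 + b_{l,i} z) e^{−b_{l,i} z} → exp(−(B − Σ δ_i²) z²/2) ∏_i (1 + δ_i z) e^{−δ_i z}`.
[cite: Schoenberg1951, §9] -/
theorem tendsto_prod_linExp_rows {b : ℕ → ℕ → ℝ} {N : ℕ → ℕ} {δ : ℕ → ℝ} {B B' : ℝ}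
    (hzero : ∀ l i, N l ≤ i → b l i = 0)
    (hanti : ∀ l, Antitone fun i => |b l i|)
    (hbound : ∀ l, ∑ i ∈ Finset.range (N l), b l i ^ 2 ≤ B')
    (hlim : ∀ i, Tendsto (fun l => b l i) atTop (𝓝 (δ i)))
    (hB : Tendsto (fun l => ∑ i ∈ Finset.range (N l), b l i ^ 2) atTop (𝓝 B)) (z : ℂ) :
    Tendsto (fun l => ∏ i ∈ Finset.range (N l), (1 + (b l i : ℂ) * z) * cexp (-((b l i : ℂ) * z)))
      atTop (𝓝 (cexp (-(((B - ∑' i, δ i ^ 2 : ℝ) : ℂ) * z ^ 2 / 2)) *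
        ∏' i, (1 + (δ i : ℂ) * z) * cexp (-((δ i : ℂ) * z)))) := by
  obtain ⟨hδ, hδB⟩ := summable_sq_of_tendsto hlim hzero hB
  have hB'0 : 0 ≤ B' := le_trans (Finset.sum_nonneg fun i _ => sq_nonneg (b 0 i)) (hbound 0)
  -- notation
  set E : ℝ → ℂ := fun u => (1 + (u : ℂ) * z) * cexp (-((u : ℂ) * z)) with hE
  have hEc : Continuous E := by
    simp only [hE]
    fun_prop
  have hE0 : E 0 = 1 := by simp [hE]
  have hEnorm : ∀ u : ℝ, ‖E u‖ ≤ Real.exp (u ^ 2 * ‖z‖ ^ 2 / 2) := by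
    intro u
    refine (norm_linExp_le _).trans ?_
    rw [norm_mul, Complex.norm_real, Real.norm_eq_abs, mul_pow, sq_abs]
  set S : ℕ → ℝ := fun l => ∑ i ∈ Finset.range (N l), b l i ^ 2 with hS
  set sq : ℕ → ℕ → ℝ := fun I l => ∑ i ∈ Finset.range I, b l i ^ 2 with hsq
  set dsq : ℕ → ℝ := fun I => ∑ i ∈ Finset.range I, δ i ^ 2 with hdsq
  set head : ℕ → ℕ → ℂ := fun I l => ∏ i ∈ Finset.range I, E (b l i) with hhead
  set HI : ℕ → ℂ := fun I => ∏ i ∈ Finset.range I, E (δ i) with hHI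
  set G : ℕ → ℕ → ℂ := fun I l => head I l * cexp (-(((S l - sq I l : ℝ) : ℂ) * z ^ 2 / 2)) with hG
  set LI : ℕ → ℂ := fun I => cexp (-(((B - dsq I : ℝ) : ℂ) * z ^ 2 / 2)) * HI I with hLI
  set L : ℂ := cexp (-(((B - ∑' i, δ i ^ 2 : ℝ) : ℂ) * z ^ 2 / 2)) *
    ∏' i, (1 + (δ i : ℂ) * z) * cexp (-((δ i : ℂ) * z)) with hL
  set mI : ℕ → ℝ := fun I => Real.sqrt (B' / (I + 1)) with hmI
  set Θ : ℕ → ℝ := fun I => Real.exp (B' * ‖z‖ ^ 2) *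
    (Real.exp (Real.exp (3 / 2) * ‖z‖ ^ 3 * mI I * B') - 1) with hΘ
  -- extension of the rows by zeros
  have hSext : ∀ l M, N l ≤ M → ∑ i ∈ Finset.range M, b l i ^ 2 = S l := by
    intro l M hM
    refine (Finset.sum_subset (Finset.range_mono hM) fun i _ hi => ?_).symm
    simp only [Finset.mem_range, not_lt] at hi
    rw [hzero l i hi]
    ring
  have hPext : ∀ l M, N l ≤ M → ∏ i ∈ Finset.range M, E (b l i) =
      ∏ i ∈ Finset.range (N l), E (b l i) := by
    intro l M hM
    refine (Finset.prod_subset (Finset.range_mono hM) fun i _ hi => ?_).symm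
    simp only [Finset.mem_range, not_lt] at hi
    rw [hzero l i hi, hE0]
  have hsqle : ∀ I l, sq I l ≤ S l := fun I l => sum_range_sq_le_of_vanish (hzero l) I
  have hbabs : ∀ l i, |b l i| ≤ mI i := fun l i =>
    abs_le_sqrt_div_of_antitone (hanti l) (hbound l) (hzero l) i
  have hmI_anti : ∀ I i, I ≤ i → mI i ≤ mI I := by
    intro I i hIi
    simp only [hmI]
    refine Real.sqrt_le_sqrt ?_
    gcongr
  have hmI0 : ∀ I, 0 ≤ mI I := fun I => Real.sqrt_nonneg _
  -- (F2)+(F3): the uniform tail estimate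
  have htail : ∀ I, mI I * ‖z‖ ≤ 1 → ∀ l,
      ‖∏ i ∈ Finset.range (N l), E (b l i) - G I l‖ ≤ Θ I := by
    intro I hI l
    set M := max I (N l) with hM
    have hIM : I ≤ M := le_max_left _ _
    have hsplit : ∏ i ∈ Finset.range (N l), E (b l i) =
        head I l * ∏ i ∈ Finset.Ico I M, E (b l i) := by
      rw [← hPext l M (le_max_right _ _), ← Finset.prod_range_mul_prod_Ico _ hIM]
    have hIco : ∑ i ∈ Finset.Ico I M, b l i ^ 2 = S l - sq I l := by
      rw [Finset.sum_Ico_eq_sub _ hIM, hSext l M (le_max_right _ _)]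
    have hsq0 : 0 ≤ sq I l := by
      simp only [hsq]
      exact Finset.sum_nonneg fun i _ => sq_nonneg _
    have hSl : S l ≤ B' := hbound l
    have hIcoB : ∑ i ∈ Finset.Ico I M, b l i ^ 2 ≤ B' := by
      rw [hIco]
      linarith
    have hT := norm_prod_linExp_sub_exp_le (u := b l) (I := I) (M := M) (z := z) (hmI0 I)
      (fun i hIi => (hbabs l i).trans (hmI_anti I i hIi)) hI hIcoB
    rw [hIco] at hT
    have hheadn : ‖head I l‖ ≤ Real.exp (B' * ‖z‖ ^ 2 / 2) := by
      calc ‖head I l‖ ≤ ∏ i ∈ Finset.range I, ‖E (b l i)‖ := Finset.norm_prod_le _ _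
        _ ≤ ∏ i ∈ Finset.range I, Real.exp (b l i ^ 2 * ‖z‖ ^ 2 / 2) :=
            Finset.prod_le_prod (fun i _ => norm_nonneg _) fun i _ => hEnorm _
        _ = Real.exp (sq I l * ‖z‖ ^ 2 / 2) := by
            rw [← Real.exp_sum, hsq]
            simp only
            rw [Finset.sum_mul, Finset.sum_div]
        _ ≤ Real.exp (B' * ‖z‖ ^ 2 / 2) := by
            refine Real.exp_le_exp.2 ?_
            gcongr
            exact (hsqle I l).trans (hbound l)
    calc ‖∏ i ∈ Finset.range (N l), E (b l i) - G I l‖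
        = ‖head I l * (∏ i ∈ Finset.Ico I M, E (b l i) -
            cexp (-(((S l - sq I l : ℝ) : ℂ) * z ^ 2 / 2)))‖ := by
          rw [hsplit, hG]
          ring_nf
      _ ≤ Real.exp (B' * ‖z‖ ^ 2 / 2) * (Real.exp (B' * ‖z‖ ^ 2 / 2) *
            (Real.exp (Real.exp (3 / 2) * ‖z‖ ^ 3 * mI I * B') - 1)) := by
          rw [norm_mul]
          exact mul_le_mul hheadn hT (norm_nonneg _) (Real.exp_pos _).le
      _ = Θ I := by
          simp only [hΘ]
          rw [← mul_assoc, ← Real.exp_add]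
          ring_nf
  -- (F4): for fixed `I`, `G I l → LI I`
  have hG_lim : ∀ I, Tendsto (G I) atTop (𝓝 (LI I)) := by
    intro I
    have h1 : Tendsto (head I) atTop (𝓝 (HI I)) :=
      tendsto_finsetProd _ fun i _ => (hEc.tendsto _).comp (hlim i)
    have h2 : Tendsto (fun l => S l - sq I l) atTop (𝓝 (B - dsq I)) :=
      hB.sub (tendsto_finsetSum _ fun i _ => (hlim i).pow 2)
    have h3 : Tendsto (fun l => cexp (-(((S l - sq I l : ℝ) : ℂ) * z ^ 2 / 2))) atTop
        (𝓝 (cexp (-(((B - dsq I : ℝ) : ℂ) * z ^ 2 / 2)))) := by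
      refine (Complex.continuous_exp.tendsto _).comp ?_
      exact (((Complex.continuous_ofReal.tendsto _).comp h2).mul_const _ |>.div_const _).neg
    simp only [hG, hLI]
    rw [mul_comm (cexp _) (HI I)]
    exact h1.mul h3
  -- (F5): `LI I → L`
  have hLI_lim : Tendsto LI atTop (𝓝 L) := by
    have h1 : Tendsto HI atTop (𝓝 (∏' i, (1 + (δ i : ℂ) * z) * cexp (-((δ i : ℂ) * z)))) :=
      tendsto_prod_range_linExp hδ z
    have h2 : Tendsto dsq atTop (𝓝 (∑' i, δ i ^ 2)) := hδ.hasSum.tendsto_sum_nat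
    have h3 : Tendsto (fun I => cexp (-(((B - dsq I : ℝ) : ℂ) * z ^ 2 / 2))) atTop
        (𝓝 (cexp (-(((B - ∑' i, δ i ^ 2 : ℝ) : ℂ) * z ^ 2 / 2)))) := by
      refine (Complex.continuous_exp.tendsto _).comp ?_
      exact (((Complex.continuous_ofReal.tendsto _).comp (h2.const_sub B)).mul_const _
        |>.div_const _).neg
    exact h3.mul h1
  -- (F6): `Θ I → 0` and eventually `mI I ‖z‖ ≤ 1`
  have hmI_lim : Tendsto mI atTop (𝓝 0) := by
    have h1 : Tendsto (fun I : ℕ => B' / ((I : ℝ) + 1)) atTop (𝓝 0) := by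
      have := (tendsto_one_div_add_atTop_nhds_zero_nat).const_mul B'
      rw [mul_zero] at this
      exact this.congr fun I => by ring
    have h2 := h1.sqrt
    rw [Real.sqrt_zero] at h2
    exact h2
  have hΘ_lim : Tendsto Θ atTop (𝓝 0) := by
    have h1 : Tendsto (fun I => Real.exp (Real.exp (3 / 2) * ‖z‖ ^ 3 * mI I * B')) atTop
        (𝓝 (Real.exp (Real.exp (3 / 2) * ‖z‖ ^ 3 * 0 * B'))) :=
      (Real.continuous_exp.tendsto _).comp ((hmI_lim.const_mul _).mul_const _)
    have h2 := (h1.sub_const 1).const_mul (Real.exp (B' * ‖z‖ ^ 2))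
    simpa [hΘ] using h2
  have hmz : ∀ᶠ I in atTop, mI I * ‖z‖ ≤ 1 := by
    have := hmI_lim.mul_const ‖z‖
    simp only [zero_mul] at this
    exact (this.eventually (ge_mem_nhds zero_lt_one))
  -- conclusion
  rw [Metric.tendsto_atTop]
  intro ε hε
  have hε3 : 0 < ε / 3 := by positivity
  have hev1 : ∀ᶠ I in atTop, dist (LI I) L < ε / 3 := Metric.tendsto_nhds.1 hLI_lim _ hε3
  have hev2 : ∀ᶠ I in atTop, Θ I < ε / 3 := by
    refine (Metric.tendsto_nhds.1 hΘ_lim _ hε3).mono fun I h => ?_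
    rw [Real.dist_eq, sub_zero] at h
    exact (le_abs_self _).trans_lt h
  obtain ⟨I, hI1, hΘI, hI3⟩ := (hev1.and (hev2.and hmz)).exists
  obtain ⟨l₀, hl₀⟩ := Metric.tendsto_atTop.1 (hG_lim I) (ε / 3) hε3
  refine ⟨l₀, fun l hl => ?_⟩
  have h1 : dist (∏ i ∈ Finset.range (N l), E (b l i)) (G I l) < ε / 3 := by
    rw [dist_eq_norm]
    exact (htail I hI3 l).trans_lt hΘI
  have h2 := hl₀ l hl
  calc dist (∏ i ∈ Finset.range (N l), E (b l i)) L
      ≤ dist (∏ i ∈ Finset.range (N l), E (b l i)) (G I l) + dist (G I l) (LI I) + dist (LI I) L :=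
        dist_triangle4 _ _ _ _
    _ < ε := by linarith

end Literature.Analysis.TotalPositivity
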